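import Literature.AlgebraicGeometry.ShimuraVarieties.UnitaryShimuraCurveEmbeddingPoints
import Literature.NumberTheory.Automorphic.AdelicDoubleQuotientDissectionFinite
import HarnessLib

/-!
# Injectivity of the embedded unitary Shimura curve, step (S1): finite double-coset representatives of
# `U(J⋆)` and the reduction of a coincidence witness to the representatives

Topic `AlgebraicGeometry/ShimuraVarieties`, namespace `…ShimuraVarieties.UnitaryCanonicalModel`.  THEOREMS ONLY (no definition,
no named fact, no instance, no `sorry`).  Cell `hodgecm-mathlib`, road (ii) of the GS-3 census, leaf R2-1-inj ([Deligne1971TravauxShimura]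
Prop. 1.15 «`u(K¹, K²)` est injectif pour `K²` assez petit» for the sub-datum `(U(J⋆), 𝔻) ↪ (U(H), 𝔹²)`), sub-leaf (S1) of the census
`A-provers/A-p15/g7/CENSUS-R2-1-inj.A-p15g7.md` §2 (B0): the FINITE REDUCTION of a coincidence witness to double-coset representatives.

SETTING (binders of ★ `UnitaryShimuraCurveEmbeddingPoints` §4): CM field `L`, `H ∈ M₃(L)`, `J⋆ ∈ M₂(L)`, a frame `ᵗ(cB)·(a·H)·B = J⋆ ⊕ J⊥`
(`a ≠ 0`), `φGS = R_B ∘ (· ⊕ 1) : U(J⋆)(𝔸_{L⁺,f}) →* U(H)(𝔸_{L⁺,f})` (★ GS-2), `embRational : U(J⋆)(L⁺) →* U(H)(L⁺)`, `γ⋆ ↦ B(γ⋆ ⊕ 1)B⁻¹`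
(★ G5).  A COINCIDENCE WITNESS for two classes `[v, uK⋆]`, `[v′, u′K⋆]` of the curve with the same image in `Sh_K(U(H))` is a rational
`γ ∈ U(H)(L⁺)` with `B^τ(v ⊕ 0) = c·γ^τ B^τ(v′ ⊕ 0)` and `φGS(u)⁻¹ γ_f φGS(u′) ∈ K` (★ `ShimuraSetGS.embPoints_mk_eq_embPoints_mk_iff`,
A-p15's (F-INJ) §2); it is BAD when it does not map `W^⊥ = B(L² ⊕ 0)` into itself.

RESULTS.
* §1 `anisotropic_of_frame` — anisotropy of `H` passes to `J⋆` through the frame (★ G2 `mul_hermForm_frameEmb_zero_eq`, `frameEmb_injective`).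
* §2 `finite_doubleCosetGS` — `U(J⋆)(L⁺) \ U(J⋆)(𝔸_{L⁺,f}) / K⋆` is FINITE for open `K⋆` (★ `finite_shimuraIndex` at `N = 2`, Godement);
  `exists_finset_doubleCoset_reps` — a finite set `S` of representatives: every `u = γ⋆_f · s · k`, `γ⋆` rational, `s ∈ S`, `k ∈ K⋆`.
* §3 `embRational_mulVec_frame_append` (`B(γ⋆ ⊕ 1)B⁻¹ · B(x ⊕ 0) = B(γ⋆x ⊕ 0)` over `L`), `forall_exists_mulVec_frame_iff_conj_embRational`
  (conjugating a witness by `embRational` elements does not change badness).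
* §4 **`exists_witness_conj_of_reps` — THE REDUCTION**: given representatives `S` and a witness `γ` for `(v, u), (v′, u′)` whose coset
  element lies in a set `Klev`, the rational `e := embRational(γ₁)⁻¹ · γ · embRational(γ₂)` (from `u = γ₁,f s k`, `u′ = γ₂,f s′ k′`) is a
  witness for `(γ₁^{-τ}v, s k), (γ₂^{-τ}v′, s′ k′)` with THE SAME coset element, the same badness, and
  `e_f ∈ φGS(S·K⋆) · Klev · φGS(K⋆·S⁻¹)`.
* §5 `isCompact_image_φGS_mul`, `image_φGS_mul_image_φGS_subset_range` — the two thickening sets are compact (finite `S`, compact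
  `K⋆`, ★ `continuous_φGS`) and their product lies in `im φGS` (the `hA`/`hC`/`hAC` of (F-INJ) §6 `forall_witness_mapsTo_frame_eventually`).

The depth argument ((F-INJ) §6 over ★ `CompactCosetDepth`), the cocompactness (S2) and the discontinuity packaging (S3) that bound
`e` in a finite set are NOT here.  [cite: Deligne1971TravauxShimura, Prop. 1.15 and its proof pp. 132–133]
[cite: Milne2005ShimuraVarieties, Lemma 5.12–5.13 p. 57] [cite: PlatonovRapinchuk1994, §5.1 (finiteness of the class number), §8.1]

## References
* [Deligne1971TravauxShimura] P. Deligne, *Travaux de Shimura*, Sém. Bourbaki 389 (1971), Prop. 1.15, pp. 132–133.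
* [Milne2005ShimuraVarieties] J. S. Milne, *Introduction to Shimura varieties* (2005/2017), Lemma 5.12, Lemma 5.13 p. 57, Thm. 5.16.
* [PlatonovRapinchuk1994] V. Platonov, A. Rapinchuk, *Algebraic Groups and Number Theory* (1994), §5.1 Thm. 5.1, §8.1.
* [GenestierNgo2020Lectures] A. Genestier, B. C. Ngô, *Lectures on Shimura varieties*, §4.6 Lemma 4.6.1.
-/

noncomputable section

open Function MulAction Topology NumberField IsDedekindDomain Matrix
open scoped Matrix Pointwise
open Literature.NumberTheory.Automorphic Literature.NumberTheory.Automorphic.UnitaryGroup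
open Literature.NumberTheory.Automorphic.ShimuraDissection
open Literature.Geometry.ComplexHyperbolic Literature.Geometry.ComplexHyperbolic.BallModel

namespace Literature.AlgebraicGeometry.ShimuraVarieties.UnitaryCanonicalModel

variable (L : Type) [Field L] [NumberField L] [IsCMField L] (H : Matrix (Fin 3) (Fin 3) L) (τ : L →+* ℂ)
  (Jstar : Matrix (Fin 2) (Fin 2) L) (Jperp : Matrix (Fin 1) (Fin 1) L) (B : GL (Fin 3) L) {a : L} (ha : a ≠ 0)
  (hB : formCongr ((IsCMField.complexConj L : L ≃ₐ[↥(maximalRealSubfield L)] L) : L →+* L) B (a • H) =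
    finSum 2 1 Jstar Jperp)

/-! ### §1 Anisotropy passes to the sub-form through the frame -/

include ha hB in
/-- **`H` anisotropic ⇒ `J⋆` anisotropic**: `a·⟨B(x ⊕ 0), B(x ⊕ 0)⟩_H = ⟨x, x⟩_{J⋆}` (★ `mul_hermForm_frameEmb_zero_eq`) and `x ↦ B(x ⊕ 0)`
is injective (★ `frameEmb_injective`). [cite: PlatonovRapinchuk1994, §2.3] [cite: Deligne1971TravauxShimura, Prop. 1.15 p. 132] -/
theorem anisotropic_of_frame (hanis : ∀ v : Fin 3 → L, hermForm (cmConjRingHom L) H v v = 0 → v = 0) :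
    ∀ x : Fin 2 → L, hermForm (cmConjRingHom L) Jstar x x = 0 → x = 0 := by
  intro x hx
  have hB' : formCongr (cmConjRingHom L) B (a • H) = finSum 2 1 Jstar Jperp := hB
  -- (★ G2 states it for `UnitaryGroup.hermForm`, definitionally the `ShimuraVarieties.hermForm` of `hanis`)
  have h : a * hermForm (cmConjRingHom L) H ((B : Matrix (Fin 3) (Fin 3) L) *ᵥ Fin.append x (0 : Fin 1 → L))
      ((B : Matrix (Fin 3) (Fin 3) L) *ᵥ Fin.append x (0 : Fin 1 → L)) = hermForm (cmConjRingHom L) Jstar x x :=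
    mul_hermForm_frameEmb_zero_eq (N₁ := 2) (N₂ := 1) (cmConjRingHom L) hB' x x
  rw [hx, mul_eq_zero] at h
  have h0 : hermForm (cmConjRingHom L) H ((B : Matrix (Fin 3) (Fin 3) L) *ᵥ Fin.append x (0 : Fin 1 → L))
      ((B : Matrix (Fin 3) (Fin 3) L) *ᵥ Fin.append x (0 : Fin 1 → L)) = 0 := h.resolve_left ha
  have hBx := hanis _ h0
  have h00 : (B : Matrix (Fin 3) (Fin 3) L) *ᵥ Fin.append (0 : Fin 2 → L) (0 : Fin 1 → L) = 0 := by
    have : Fin.append (0 : Fin 2 → L) (0 : Fin 1 → L) = 0 := by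
      funext i; refine Fin.addCases (fun j => ?_) (fun j => ?_) i <;> simp
    rw [this, Matrix.mulVec_zero]
  exact frameEmb_injective (N₁ := 2) (N₂ := 1) B (hBx.trans h00.symm)

/-! ### §2 Finiteness of the double coset space of the curve datum and representatives -/

include ha hB in
/-- **`U(J⋆)(L⁺) \ U(J⋆)(𝔸_{L⁺,f}) / K⋆` is finite** for every open `K⋆` ([PlatonovRapinchuk1994] Thm. 5.1; here ★ `finite_shimuraIndex`
at `N = 2`: Godement compactness for the anisotropic `J⋆` + openness), anisotropy of `J⋆` coming from that of `H` through the frame.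
[cite: PlatonovRapinchuk1994, §5.1 Thm. 5.1 and §8.1] [cite: Milne2005ShimuraVarieties, Lemma 5.12 p. 57] -/
theorem finite_doubleCosetGS (hanis : ∀ v : Fin 3 → L, hermForm (cmConjRingHom L) H v v = 0 → v = 0)
    (Kstar : Subgroup ↥(finAdelic (↥(maximalRealSubfield L)) L (IsCMField.complexConj L) 2 Jstar))
    (hKo : IsOpen (Kstar : Set ↥(finAdelic (↥(maximalRealSubfield L)) L (IsCMField.complexConj L) 2 Jstar))) :
    Finite (orbitRel.Quotient ↥(rational (↥(maximalRealSubfield L)) L (IsCMField.complexConj L) 2 Jstar)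
      (CosetSpace (rationalToFinAdelic (↥(maximalRealSubfield L)) L (IsCMField.complexConj L) 2 Jstar) Kstar)) :=
  finite_shimuraIndex L 2 Jstar (anisotropic_of_frame L H Jstar Jperp B ha hB hanis) Kstar hKo

set_option maxHeartbeats 400000 in -- instance-heavy adelic statement (as ★ `UnitaryShimuraCurveEmbeddingDescent` §2)
include ha hB in
/-- **Finite representatives**: for open `K⋆ ≤ U(J⋆)(𝔸_{L⁺,f})` there is a finite set `S ⊆ U(J⋆)(𝔸_{L⁺,f})` such that every `u` is
`γ⋆_f · s · k` with `γ⋆ ∈ U(J⋆)(L⁺)`, `s ∈ S`, `k ∈ K⋆` (one representative per double coset; census (B0)).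
[cite: Milne2005ShimuraVarieties, Lemma 5.12–5.13 p. 57] [cite: GenestierNgo2020Lectures, §4.6 Lemma 4.6.1] -/
theorem exists_finset_doubleCoset_reps (hanis : ∀ v : Fin 3 → L, hermForm (cmConjRingHom L) H v v = 0 → v = 0)
    (Kstar : Subgroup ↥(finAdelic (↥(maximalRealSubfield L)) L (IsCMField.complexConj L) 2 Jstar))
    (hKo : IsOpen (Kstar : Set ↥(finAdelic (↥(maximalRealSubfield L)) L (IsCMField.complexConj L) 2 Jstar))) :
    ∃ S : Finset ↥(finAdelic (↥(maximalRealSubfield L)) L (IsCMField.complexConj L) 2 Jstar),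
      ∀ u : ↥(finAdelic (↥(maximalRealSubfield L)) L (IsCMField.complexConj L) 2 Jstar),
        ∃ (γ : ↥(rational (↥(maximalRealSubfield L)) L (IsCMField.complexConj L) 2 Jstar)) (s : ↥(finAdelic
          (↥(maximalRealSubfield L)) L (IsCMField.complexConj L) 2 Jstar)) (_ : s ∈ S) (k : ↥(finAdelic
          (↥(maximalRealSubfield L)) L (IsCMField.complexConj L) 2 Jstar)) (_ : k ∈ Kstar),
          u = (rationalToFinAdelic (↥(maximalRealSubfield L)) L (IsCMField.complexConj L) 2 Jstar γ :
            ↥(finAdelic (↥(maximalRealSubfield L)) L (IsCMField.complexConj L) 2 Jstar)) * s * k := by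
  classical
  haveI := finite_doubleCosetGS L H Jstar Jperp B ha hB hanis Kstar hKo
  set Q := orbitRel.Quotient ↥(rational (↥(maximalRealSubfield L)) L (IsCMField.complexConj L) 2 Jstar)
      (CosetSpace (rationalToFinAdelic (↥(maximalRealSubfield L)) L (IsCMField.complexConj L) 2 Jstar) Kstar) with hQ
  haveI : Fintype Q := Fintype.ofFinite Q
  -- a representative of each class
  have hrep : ∀ q : Q, ∃ g : ↥(finAdelic (↥(maximalRealSubfield L)) L (IsCMField.complexConj L) 2 Jstar),
      (Quotient.mk'' (CosetSpace.pt (rationalToFinAdelic (↥(maximalRealSubfield L)) L (IsCMField.complexConj L) 2 Jstar)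
        Kstar g) : Q) = q := by
    intro q
    induction q using Quotient.inductionOn' with | h x => ?_
    obtain ⟨g, rfl⟩ := CosetSpace.pt_surjective
      (rationalToFinAdelic (↥(maximalRealSubfield L)) L (IsCMField.complexConj L) 2 Jstar) Kstar x
    exact ⟨g, rfl⟩
  choose g hg using hrep
  refine ⟨Finset.univ.image g, fun u => ?_⟩
  set q : Q := Quotient.mk'' (CosetSpace.pt (rationalToFinAdelic (↥(maximalRealSubfield L)) L
    (IsCMField.complexConj L) 2 Jstar) Kstar u) with hq
  -- `pt (g q)` and `pt u` lie in the same `U(J⋆)(L⁺)`-orbit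
  have horb : (orbitRel ↥(rational (↥(maximalRealSubfield L)) L (IsCMField.complexConj L) 2 Jstar)
      (CosetSpace (rationalToFinAdelic (↥(maximalRealSubfield L)) L (IsCMField.complexConj L) 2 Jstar) Kstar))
      (CosetSpace.pt (rationalToFinAdelic (↥(maximalRealSubfield L)) L (IsCMField.complexConj L) 2 Jstar) Kstar (g q))
      (CosetSpace.pt (rationalToFinAdelic (↥(maximalRealSubfield L)) L (IsCMField.complexConj L) 2 Jstar) Kstar u) :=
    Quotient.exact' ((hg q).trans hq)
  obtain ⟨γ, hγ⟩ := MulAction.orbitRel_apply.1 horb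
  -- `γ • pt u = pt (g q)`, i.e. `pt (γ_f * u) = pt (g q)`, i.e. `(γ_f * u)⁻¹ * g q ∈ K⋆`
  dsimp only at hγ
  rw [CosetSpace.smul_pt, CosetSpace.pt_eq_pt_iff] at hγ
  set γf : ↥(finAdelic (↥(maximalRealSubfield L)) L (IsCMField.complexConj L) 2 Jstar) :=
    rationalToFinAdelic (↥(maximalRealSubfield L)) L (IsCMField.complexConj L) 2 Jstar γ with hγf
  refine ⟨γ⁻¹, g q, Finset.mem_image_of_mem g (Finset.mem_univ q), ((γf * u)⁻¹ * g q)⁻¹, Kstar.inv_mem hγ, ?_⟩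
  rw [map_inv, ← hγf]
  group

/-! ### §3 The sub-datum's rational points act on `W^⊥ = B(L² ⊕ 0)`; badness is invariant under them -/

/-- **`B(γ⋆ ⊕ 1)B⁻¹ · B(x ⊕ 0) = B(γ⋆ x ⊕ 0)`** over `L`: the rational points `embRational γ⋆` of the sub-datum map `B(L² ⊕ 0)` onto
itself through `γ⋆` (★ G2 `conj_finSum_one_right_mulVec_frameEmb_zero`). [cite: PlatonovRapinchuk1994, §2.3] -/
theorem embRational_mulVec_frame_append (γs : ↥(rational (↥(maximalRealSubfield L)) L (IsCMField.complexConj L) 2 Jstar))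
    (x : Fin 2 → L) :
    (((embRational (↥(maximalRealSubfield L)) L (IsCMField.complexConj L) 2 1 Jstar Jperp H B ha hB γs :
        ↥(rational (↥(maximalRealSubfield L)) L (IsCMField.complexConj L) 3 H)) : GL (Fin 3) L) : Matrix (Fin 3) (Fin 3) L) *ᵥ
        ((B : Matrix (Fin 3) (Fin 3) L) *ᵥ Fin.append x (0 : Fin 1 → L)) =
      (B : Matrix (Fin 3) (Fin 3) L) *ᵥ Fin.append ((((γs : ↥(rational (↥(maximalRealSubfield L)) L
        (IsCMField.complexConj L) 2 Jstar)) : GL (Fin 2) L) : Matrix (Fin 2) (Fin 2) L) *ᵥ x) (0 : Fin 1 → L) := by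
  have hcoe : (((embRational (↥(maximalRealSubfield L)) L (IsCMField.complexConj L) 2 1 Jstar Jperp H B ha hB γs :
        ↥(rational (↥(maximalRealSubfield L)) L (IsCMField.complexConj L) 3 H)) : GL (Fin 3) L) : Matrix (Fin 3) (Fin 3) L) =
      (B : Matrix (Fin 3) (Fin 3) L) *
        finSum 2 1 (((γs : ↥(rational (↥(maximalRealSubfield L)) L (IsCMField.complexConj L) 2 Jstar)) : GL (Fin 2) L) :
          Matrix (Fin 2) (Fin 2) L) 1 *
        ((B⁻¹ : GL (Fin 3) L) : Matrix (Fin 3) (Fin 3) L) := by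
    rw [coe_embRational, Units.val_mul, Units.val_mul]
    rfl
  rw [hcoe]
  exact conj_finSum_one_right_mulVec_frameEmb_zero (N₁ := 2) (N₂ := 1) B _ x

/-- **Conjugating by the sub-datum does not change «maps `W^⊥` into itself»**: for `γ ∈ U(H)(L⁺)` and `γ₁, γ₂ ∈ U(J⋆)(L⁺)`,
`γ` maps `B(L² ⊕ 0)` into itself iff `embRational(γ₁)⁻¹ · γ · embRational(γ₂)` does. [cite: Deligne1971TravauxShimura, Prop. 1.15 proof p. 132] -/
theorem forall_exists_mulVec_frame_iff_conj_embRational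
    (γ : ↥(rational (↥(maximalRealSubfield L)) L (IsCMField.complexConj L) 3 H))
    (γ₁ γ₂ : ↥(rational (↥(maximalRealSubfield L)) L (IsCMField.complexConj L) 2 Jstar)) :
    (∀ x : Fin 2 → L, ∃ y : Fin 2 → L,
        ((γ : GL (Fin 3) L) : Matrix (Fin 3) (Fin 3) L) *ᵥ ((B : Matrix (Fin 3) (Fin 3) L) *ᵥ Fin.append x (0 : Fin 1 → L)) =
          (B : Matrix (Fin 3) (Fin 3) L) *ᵥ Fin.append y (0 : Fin 1 → L)) ↔
      ∀ x : Fin 2 → L, ∃ y : Fin 2 → L,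
        ((((embRational (↥(maximalRealSubfield L)) L (IsCMField.complexConj L) 2 1 Jstar Jperp H B ha hB γ₁)⁻¹ * γ *
            embRational (↥(maximalRealSubfield L)) L (IsCMField.complexConj L) 2 1 Jstar Jperp H B ha hB γ₂ :
            ↥(rational (↥(maximalRealSubfield L)) L (IsCMField.complexConj L) 3 H)) : GL (Fin 3) L) : Matrix (Fin 3) (Fin 3) L) *ᵥ
            ((B : Matrix (Fin 3) (Fin 3) L) *ᵥ Fin.append x (0 : Fin 1 → L)) =
          (B : Matrix (Fin 3) (Fin 3) L) *ᵥ Fin.append y (0 : Fin 1 → L) := by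
  -- abbreviations for the two block elements as matrices
  set E₁ : Matrix (Fin 3) (Fin 3) L := (((embRational (↥(maximalRealSubfield L)) L (IsCMField.complexConj L) 2 1 Jstar Jperp H B
    ha hB γ₁ : ↥(rational (↥(maximalRealSubfield L)) L (IsCMField.complexConj L) 3 H)) : GL (Fin 3) L) : Matrix (Fin 3) (Fin 3) L)
    with hE₁
  set E₂ : Matrix (Fin 3) (Fin 3) L := (((embRational (↥(maximalRealSubfield L)) L (IsCMField.complexConj L) 2 1 Jstar Jperp H B
    ha hB γ₂ : ↥(rational (↥(maximalRealSubfield L)) L (IsCMField.complexConj L) 3 H)) : GL (Fin 3) L) : Matrix (Fin 3) (Fin 3) L)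
    with hE₂
  set E₁' : Matrix (Fin 3) (Fin 3) L := (((embRational (↥(maximalRealSubfield L)) L (IsCMField.complexConj L) 2 1 Jstar Jperp H B
    ha hB γ₁⁻¹ : ↥(rational (↥(maximalRealSubfield L)) L (IsCMField.complexConj L) 3 H)) : GL (Fin 3) L) : Matrix (Fin 3) (Fin 3) L)
    with hE₁'
  set G : Matrix (Fin 3) (Fin 3) L := ((γ : GL (Fin 3) L) : Matrix (Fin 3) (Fin 3) L) with hG
  -- the conjugate as a matrix product
  have hconj : ((((embRational (↥(maximalRealSubfield L)) L (IsCMField.complexConj L) 2 1 Jstar Jperp H B ha hB γ₁)⁻¹ * γ *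
        embRational (↥(maximalRealSubfield L)) L (IsCMField.complexConj L) 2 1 Jstar Jperp H B ha hB γ₂ :
        ↥(rational (↥(maximalRealSubfield L)) L (IsCMField.complexConj L) 3 H)) : GL (Fin 3) L) : Matrix (Fin 3) (Fin 3) L) =
      E₁' * G * E₂ := by
    rw [← map_inv, Subgroup.coe_mul, Subgroup.coe_mul, Units.val_mul, Units.val_mul]
  -- actions of `E₁`, `E₁'`, `E₂` on the frame vectors
  have h1 : ∀ x : Fin 2 → L, E₁ *ᵥ ((B : Matrix (Fin 3) (Fin 3) L) *ᵥ Fin.append x (0 : Fin 1 → L)) =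
      (B : Matrix (Fin 3) (Fin 3) L) *ᵥ Fin.append ((((γ₁ : ↥(rational (↥(maximalRealSubfield L)) L
        (IsCMField.complexConj L) 2 Jstar)) : GL (Fin 2) L) : Matrix (Fin 2) (Fin 2) L) *ᵥ x) (0 : Fin 1 → L) :=
    fun x => embRational_mulVec_frame_append L H Jstar Jperp B ha hB γ₁ x
  have h1' : ∀ x : Fin 2 → L, E₁' *ᵥ ((B : Matrix (Fin 3) (Fin 3) L) *ᵥ Fin.append x (0 : Fin 1 → L)) =
      (B : Matrix (Fin 3) (Fin 3) L) *ᵥ Fin.append ((((γ₁⁻¹ : ↥(rational (↥(maximalRealSubfield L)) L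
        (IsCMField.complexConj L) 2 Jstar)) : GL (Fin 2) L) : Matrix (Fin 2) (Fin 2) L) *ᵥ x) (0 : Fin 1 → L) :=
    fun x => embRational_mulVec_frame_append L H Jstar Jperp B ha hB γ₁⁻¹ x
  have h2 : ∀ x : Fin 2 → L, E₂ *ᵥ ((B : Matrix (Fin 3) (Fin 3) L) *ᵥ Fin.append x (0 : Fin 1 → L)) =
      (B : Matrix (Fin 3) (Fin 3) L) *ᵥ Fin.append ((((γ₂ : ↥(rational (↥(maximalRealSubfield L)) L
        (IsCMField.complexConj L) 2 Jstar)) : GL (Fin 2) L) : Matrix (Fin 2) (Fin 2) L) *ᵥ x) (0 : Fin 1 → L) :=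
    fun x => embRational_mulVec_frame_append L H Jstar Jperp B ha hB γ₂ x
  -- `E₁ * E₁' = 1`
  have hE : E₁ * E₁' = 1 := by
    rw [hE₁, hE₁', ← Units.val_mul, ← Subgroup.coe_mul, ← map_mul, mul_inv_cancel, map_one, OneMemClass.coe_one, Units.val_one]
  rw [hconj]
  constructor
  · intro h x
    -- `E₁' G E₂ B(x⊕0) = E₁' G B(γ₂x ⊕ 0) = E₁' B(y ⊕ 0) = B(γ₁⁻¹ y ⊕ 0)`
    obtain ⟨y, hy⟩ := h ((((γ₂ : ↥(rational (↥(maximalRealSubfield L)) L (IsCMField.complexConj L) 2 Jstar)) : GL (Fin 2) L) :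
      Matrix (Fin 2) (Fin 2) L) *ᵥ x)
    refine ⟨(((γ₁⁻¹ : ↥(rational (↥(maximalRealSubfield L)) L (IsCMField.complexConj L) 2 Jstar)) : GL (Fin 2) L) :
      Matrix (Fin 2) (Fin 2) L) *ᵥ y, ?_⟩
    rw [← Matrix.mulVec_mulVec, ← Matrix.mulVec_mulVec, h2 x, hy, h1' y]
  · intro h x
    -- `G B(x⊕0) = E₁ (E₁' G E₂) B(γ₂⁻¹x ⊕ 0)`
    set x' : Fin 2 → L := (((γ₂⁻¹ : ↥(rational (↥(maximalRealSubfield L)) L (IsCMField.complexConj L) 2 Jstar)) : GL (Fin 2) L) :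
      Matrix (Fin 2) (Fin 2) L) *ᵥ x with hx'
    obtain ⟨y, hy⟩ := h x'
    refine ⟨(((γ₁ : ↥(rational (↥(maximalRealSubfield L)) L (IsCMField.complexConj L) 2 Jstar)) : GL (Fin 2) L) :
      Matrix (Fin 2) (Fin 2) L) *ᵥ y, ?_⟩
    have hx2 : E₂ *ᵥ ((B : Matrix (Fin 3) (Fin 3) L) *ᵥ Fin.append x' (0 : Fin 1 → L)) =
        (B : Matrix (Fin 3) (Fin 3) L) *ᵥ Fin.append x (0 : Fin 1 → L) := by
      rw [h2 x', hx', Matrix.mulVec_mulVec, ← Units.val_mul, ← Subgroup.coe_mul, mul_inv_cancel, OneMemClass.coe_one,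
        Units.val_one, Matrix.one_mulVec]
    rw [← Matrix.mulVec_mulVec, ← Matrix.mulVec_mulVec, hx2] at hy
    -- `hy : E₁' *ᵥ (G *ᵥ B(x⊕0)) = B(y ⊕ 0)`; apply `E₁`
    have key : E₁ *ᵥ (E₁' *ᵥ (G *ᵥ ((B : Matrix (Fin 3) (Fin 3) L) *ᵥ Fin.append x (0 : Fin 1 → L)))) =
        E₁ *ᵥ ((B : Matrix (Fin 3) (Fin 3) L) *ᵥ Fin.append y (0 : Fin 1 → L)) := by rw [hy]
    rw [Matrix.mulVec_mulVec, hE, Matrix.one_mulVec, h1 y] at key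
    exact key

/-! ### §4 THE REDUCTION of a coincidence witness to the representatives -/

section Reduction

variable (hτa : 0 < (τ a).re) (hτa' : (τ a).im = 0)
  (Kstar : Subgroup ↥(finAdelic (↥(maximalRealSubfield L)) L (IsCMField.complexConj L) 2 Jstar))

/-- `γ^{-τ} v` is negative when `v` is (★ `smul_ratToGLℂ_mulVec_mem_negCone` with `c = 1`). [cite: Milne2005ShimuraVarieties, §5 (5.1) p. 56] -/
private theorem ratToGLℂ_mulVec_mem_negCone' (γ : ↥(rational (↥(maximalRealSubfield L)) L (IsCMField.complexConj L) 2 Jstar))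
    {v : Fin 2 → ℂ} (hv : v ∈ negCone (Jstar.map τ)) :
    ((ratToGLℂ L Jstar τ γ : GL (Fin 2) ℂ) : Matrix (Fin 2) (Fin 2) ℂ) *ᵥ v ∈ negCone (Jstar.map τ) := by
  have h := smul_ratToGLℂ_mulVec_mem_negCone L Jstar τ γ one_ne_zero hv
  rwa [one_smul] at h

set_option maxHeartbeats 400000 in -- instance-heavy adelic statement (as ★ `UnitaryShimuraCurveEmbeddingDescent` §2)
/-- **THE REDUCTION (census (B0)).**  Let `S` be a set of representatives (`u = γ⋆_f s k`).  A coincidence witness `γ ∈ U(H)(L⁺)` for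
`(v, u), (v′, u′)` — `B^τ(v ⊕ 0) = c·γ^τ B^τ(v′ ⊕ 0)`, coset element `φGS(u)⁻¹ γ_f φGS(u′) ∈ Klev` — yields, writing `u = γ₁,f s k`,
`u′ = γ₂,f s′ k′`, the rational `e := embRational(γ₁)⁻¹ · γ · embRational(γ₂)`, which is a witness for `(γ₁^{-τ} v, s k), (γ₂^{-τ} v′, s′ k′)`
with THE SAME coset element (`φGS(sk)⁻¹ e_f φGS(s′k′) = φGS(u)⁻¹ γ_f φGS(u′)`), hence `e_f ∈ φGS(S·K⋆) · Klev · φGS(K⋆·S⁻¹)`, and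
with the same badness (`γ` maps `B(L² ⊕ 0)` into itself iff `e` does). [cite: Deligne1971TravauxShimura, Prop. 1.15 proof pp. 132–133]
[cite: Milne2005ShimuraVarieties, Lemma 5.13 p. 57] -/
theorem exists_witness_conj_of_reps (S : Set ↥(finAdelic (↥(maximalRealSubfield L)) L (IsCMField.complexConj L) 2 Jstar))
    (hS : ∀ u : ↥(finAdelic (↥(maximalRealSubfield L)) L (IsCMField.complexConj L) 2 Jstar),
        ∃ (γ : ↥(rational (↥(maximalRealSubfield L)) L (IsCMField.complexConj L) 2 Jstar)) (s : ↥(finAdelic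
          (↥(maximalRealSubfield L)) L (IsCMField.complexConj L) 2 Jstar)) (_ : s ∈ S) (k : ↥(finAdelic
          (↥(maximalRealSubfield L)) L (IsCMField.complexConj L) 2 Jstar)) (_ : k ∈ Kstar),
          u = (rationalToFinAdelic (↥(maximalRealSubfield L)) L (IsCMField.complexConj L) 2 Jstar γ :
            ↥(finAdelic (↥(maximalRealSubfield L)) L (IsCMField.complexConj L) 2 Jstar)) * s * k)
    (Klev : Set ↥(finAdelic (↥(maximalRealSubfield L)) L (IsCMField.complexConj L) 3 H))
    (γ : ↥(rational (↥(maximalRealSubfield L)) L (IsCMField.complexConj L) 3 H)) (v v' : Fin 2 → ℂ)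
    (hv : v ∈ negCone (Jstar.map τ)) (hv' : v' ∈ negCone (Jstar.map τ))
    (u u' : ↥(finAdelic (↥(maximalRealSubfield L)) L (IsCMField.complexConj L) 2 Jstar))
    (hball : ∃ c : ℂ, c ≠ 0 ∧ frameEmbNeg τ B v =
      c • (((Matrix.GeneralLinearGroup.map τ (γ : GL (Fin 3) L) : GL (Fin 3) ℂ) : Matrix (Fin 3) (Fin 3) ℂ) *ᵥ frameEmbNeg τ B v'))
    (hcoset : ((φGS L Jstar Jperp H B ha hB u)⁻¹ *
        (rationalToFinAdelic (↥(maximalRealSubfield L)) L (IsCMField.complexConj L) 3 H γ * φGS L Jstar Jperp H B ha hB u') :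
        ↥(finAdelic (↥(maximalRealSubfield L)) L (IsCMField.complexConj L) 3 H)) ∈ Klev) :
    ∃ (e : ↥(rational (↥(maximalRealSubfield L)) L (IsCMField.complexConj L) 3 H)) (v₁ v₁' : Fin 2 → ℂ)
      (_ : v₁ ∈ negCone (Jstar.map τ)) (_ : v₁' ∈ negCone (Jstar.map τ))
      (s : ↥(finAdelic (↥(maximalRealSubfield L)) L (IsCMField.complexConj L) 2 Jstar)) (_ : s ∈ S)
      (s' : ↥(finAdelic (↥(maximalRealSubfield L)) L (IsCMField.complexConj L) 2 Jstar)) (_ : s' ∈ S)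
      (k : ↥(finAdelic (↥(maximalRealSubfield L)) L (IsCMField.complexConj L) 2 Jstar)) (_ : k ∈ Kstar)
      (k' : ↥(finAdelic (↥(maximalRealSubfield L)) L (IsCMField.complexConj L) 2 Jstar)) (_ : k' ∈ Kstar),
      (∃ c : ℂ, c ≠ 0 ∧ frameEmbNeg τ B v₁ =
        c • (((Matrix.GeneralLinearGroup.map τ (e : GL (Fin 3) L) : GL (Fin 3) ℂ) : Matrix (Fin 3) (Fin 3) ℂ) *ᵥ frameEmbNeg τ B v₁')) ∧
      ((φGS L Jstar Jperp H B ha hB (s * k))⁻¹ *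
          (rationalToFinAdelic (↥(maximalRealSubfield L)) L (IsCMField.complexConj L) 3 H e * φGS L Jstar Jperp H B ha hB (s' * k')) :
          ↥(finAdelic (↥(maximalRealSubfield L)) L (IsCMField.complexConj L) 3 H)) =
        (φGS L Jstar Jperp H B ha hB u)⁻¹ *
          (rationalToFinAdelic (↥(maximalRealSubfield L)) L (IsCMField.complexConj L) 3 H γ * φGS L Jstar Jperp H B ha hB u') ∧
      (rationalToFinAdelic (↥(maximalRealSubfield L)) L (IsCMField.complexConj L) 3 H e :
          ↥(finAdelic (↥(maximalRealSubfield L)) L (IsCMField.complexConj L) 3 H)) ∈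
        (⇑(φGS L Jstar Jperp H B ha hB) '' (S * (Kstar : Set _))) * Klev * (⇑(φGS L Jstar Jperp H B ha hB) '' ((Kstar : Set _) * S⁻¹)) ∧
      ((∀ x : Fin 2 → L, ∃ y : Fin 2 → L,
          ((γ : GL (Fin 3) L) : Matrix (Fin 3) (Fin 3) L) *ᵥ ((B : Matrix (Fin 3) (Fin 3) L) *ᵥ Fin.append x (0 : Fin 1 → L)) =
            (B : Matrix (Fin 3) (Fin 3) L) *ᵥ Fin.append y (0 : Fin 1 → L)) ↔
        ∀ x : Fin 2 → L, ∃ y : Fin 2 → L,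
          ((e : GL (Fin 3) L) : Matrix (Fin 3) (Fin 3) L) *ᵥ ((B : Matrix (Fin 3) (Fin 3) L) *ᵥ Fin.append x (0 : Fin 1 → L)) =
            (B : Matrix (Fin 3) (Fin 3) L) *ᵥ Fin.append y (0 : Fin 1 → L)) := by
  obtain ⟨γ₁, s, hs, k, hk, hu⟩ := hS u
  obtain ⟨γ₂, s', hs', k', hk', hu'⟩ := hS u'
  set e : ↥(rational (↥(maximalRealSubfield L)) L (IsCMField.complexConj L) 3 H) :=
    (embRational (↥(maximalRealSubfield L)) L (IsCMField.complexConj L) 2 1 Jstar Jperp H B ha hB γ₁)⁻¹ * γ *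
      embRational (↥(maximalRealSubfield L)) L (IsCMField.complexConj L) 2 1 Jstar Jperp H B ha hB γ₂ with he
  -- the finite-adelic image of `e`
  have hef : (rationalToFinAdelic (↥(maximalRealSubfield L)) L (IsCMField.complexConj L) 3 H e :
        ↥(finAdelic (↥(maximalRealSubfield L)) L (IsCMField.complexConj L) 3 H)) =
      (φGS L Jstar Jperp H B ha hB (rationalToFinAdelic (↥(maximalRealSubfield L)) L (IsCMField.complexConj L) 2 Jstar γ₁))⁻¹ *
        rationalToFinAdelic (↥(maximalRealSubfield L)) L (IsCMField.complexConj L) 3 H γ *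
        φGS L Jstar Jperp H B ha hB (rationalToFinAdelic (↥(maximalRealSubfield L)) L (IsCMField.complexConj L) 2 Jstar γ₂) := by
    rw [he, map_mul, map_mul, map_inv, rationalToFinAdelic_embRational_eq_φGS, rationalToFinAdelic_embRational_eq_φGS]
  -- the coset element is unchanged
  have hcos : ((φGS L Jstar Jperp H B ha hB (s * k))⁻¹ *
        (rationalToFinAdelic (↥(maximalRealSubfield L)) L (IsCMField.complexConj L) 3 H e * φGS L Jstar Jperp H B ha hB (s' * k')) :
        ↥(finAdelic (↥(maximalRealSubfield L)) L (IsCMField.complexConj L) 3 H)) =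
      (φGS L Jstar Jperp H B ha hB u)⁻¹ *
        (rationalToFinAdelic (↥(maximalRealSubfield L)) L (IsCMField.complexConj L) 3 H γ * φGS L Jstar Jperp H B ha hB u') := by
    rw [hef, hu, hu']
    simp only [map_mul]
    group
  refine ⟨e, ((ratToGLℂ L Jstar τ γ₁⁻¹ : GL (Fin 2) ℂ) : Matrix (Fin 2) (Fin 2) ℂ) *ᵥ v,
    ((ratToGLℂ L Jstar τ γ₂⁻¹ : GL (Fin 2) ℂ) : Matrix (Fin 2) (Fin 2) ℂ) *ᵥ v',
    ratToGLℂ_mulVec_mem_negCone' L τ Jstar γ₁⁻¹ hv, ratToGLℂ_mulVec_mem_negCone' L τ Jstar γ₂⁻¹ hv',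
    s, hs, s', hs', k, hk, k', hk', ?_, hcos, ?_, ?_⟩
  · -- the ball condition for `e`
    obtain ⟨c, hc, hcv⟩ := hball
    refine ⟨c, hc, ?_⟩
    -- `e^τ · B^τ(γ₂^{-τ}v′ ⊕ 0) = emb(γ₁)^{-τ} γ^τ B^τ(v′ ⊕ 0)` and `B^τ(γ₁^{-τ} v ⊕ 0) = emb(γ₁)^{-τ} B^τ(v ⊕ 0)`
    have hEe : ((Matrix.GeneralLinearGroup.map τ (e : GL (Fin 3) L) : GL (Fin 3) ℂ) : Matrix (Fin 3) (Fin 3) ℂ) =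
        ((Matrix.GeneralLinearGroup.map τ
            ((embRational (↥(maximalRealSubfield L)) L (IsCMField.complexConj L) 2 1 Jstar Jperp H B ha hB γ₁⁻¹ :
              ↥(rational (↥(maximalRealSubfield L)) L (IsCMField.complexConj L) 3 H)) : GL (Fin 3) L) : GL (Fin 3) ℂ) :
              Matrix (Fin 3) (Fin 3) ℂ) *
          ((Matrix.GeneralLinearGroup.map τ (γ : GL (Fin 3) L) : GL (Fin 3) ℂ) : Matrix (Fin 3) (Fin 3) ℂ) *
          ((Matrix.GeneralLinearGroup.map τ
            ((embRational (↥(maximalRealSubfield L)) L (IsCMField.complexConj L) 2 1 Jstar Jperp H B ha hB γ₂ :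
              ↥(rational (↥(maximalRealSubfield L)) L (IsCMField.complexConj L) 3 H)) : GL (Fin 3) L) : GL (Fin 3) ℂ) :
              Matrix (Fin 3) (Fin 3) ℂ) := by
      rw [he, ← map_inv, Subgroup.coe_mul, Subgroup.coe_mul, map_mul, map_mul, Units.val_mul, Units.val_mul]
    have hv'' : ((ratToGLℂ L Jstar τ γ₂ : GL (Fin 2) ℂ) : Matrix (Fin 2) (Fin 2) ℂ) *ᵥ
        (((ratToGLℂ L Jstar τ γ₂⁻¹ : GL (Fin 2) ℂ) : Matrix (Fin 2) (Fin 2) ℂ) *ᵥ v') = v' := by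
      rw [Matrix.mulVec_mulVec, ← Units.val_mul, ← map_mul, mul_inv_cancel, map_one, Units.val_one, Matrix.one_mulVec]
    rw [hEe, ← Matrix.mulVec_mulVec, ← Matrix.mulVec_mulVec,
      map_embRational_mulVec_frameEmbNeg H Jstar Jperp B ha hB γ₂, hv'', ← Matrix.mulVec_smul, ← hcv,
      map_embRational_mulVec_frameEmbNeg H Jstar Jperp B ha hB γ₁⁻¹]
  · -- membership `e_f ∈ φGS(S·K⋆) · Klev · φGS(K⋆·S⁻¹)`
    have hmem : (rationalToFinAdelic (↥(maximalRealSubfield L)) L (IsCMField.complexConj L) 3 H e :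
          ↥(finAdelic (↥(maximalRealSubfield L)) L (IsCMField.complexConj L) 3 H)) =
        φGS L Jstar Jperp H B ha hB (s * k) *
          ((φGS L Jstar Jperp H B ha hB u)⁻¹ *
            (rationalToFinAdelic (↥(maximalRealSubfield L)) L (IsCMField.complexConj L) 3 H γ * φGS L Jstar Jperp H B ha hB u')) *
          φGS L Jstar Jperp H B ha hB (k'⁻¹ * s'⁻¹) := by
      rw [← hcos]
      simp only [map_mul, map_inv]
      group
    rw [hmem]
    refine Set.mul_mem_mul (Set.mul_mem_mul ⟨s * k, Set.mul_mem_mul hs hk, rfl⟩ hcoset)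
      ⟨k'⁻¹ * s'⁻¹, Set.mul_mem_mul (Kstar.inv_mem hk') (Set.inv_mem_inv.2 hs'), rfl⟩
  · exact forall_exists_mulVec_frame_iff_conj_embRational L H Jstar Jperp B ha hB γ γ₁ γ₂

end Reduction

/-! ### §5 The thickening sets are compact and lie in `im φGS` -/

/-- **`φGS(S·K⋆)` and `φGS(K⋆·S⁻¹)` are compact** for finite `S` and compact `K⋆` (★ `continuous_φGS`).
[cite: PlatonovRapinchuk1994, §5.1] -/
theorem isCompact_image_φGS_mul (S : Finset ↥(finAdelic (↥(maximalRealSubfield L)) L (IsCMField.complexConj L) 2 Jstar))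
    (Kstar : Subgroup ↥(finAdelic (↥(maximalRealSubfield L)) L (IsCMField.complexConj L) 2 Jstar))
    (hKc : IsCompact (Kstar : Set ↥(finAdelic (↥(maximalRealSubfield L)) L (IsCMField.complexConj L) 2 Jstar))) :
    IsCompact (⇑(φGS L Jstar Jperp H B ha hB) '' ((S : Set _) * (Kstar : Set _))) ∧
      IsCompact (⇑(φGS L Jstar Jperp H B ha hB) '' ((Kstar : Set _) * (S : Set _)⁻¹)) :=
  ⟨(S.finite_toSet.isCompact.mul hKc).image (continuous_φGS L Jstar Jperp H B ha hB),
    (hKc.mul S.finite_toSet.inv.isCompact).image (continuous_φGS L Jstar Jperp H B ha hB)⟩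

/-- **The product of the two thickening sets lies in `im φGS`** (images of a homomorphism multiply into the image).
[cite: PlatonovRapinchuk1994, §5.1] -/
theorem image_φGS_mul_image_φGS_subset_range (X Y : Set ↥(finAdelic (↥(maximalRealSubfield L)) L (IsCMField.complexConj L) 2 Jstar)) :
    (⇑(φGS L Jstar Jperp H B ha hB) '' X) * (⇑(φGS L Jstar Jperp H B ha hB) '' Y) ⊆ Set.range ⇑(φGS L Jstar Jperp H B ha hB) := by
  rintro _ ⟨_, ⟨x, -, rfl⟩, _, ⟨y, -, rfl⟩, rfl⟩
  exact ⟨x * y, map_mul _ x y⟩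

end Literature.AlgebraicGeometry.ShimuraVarieties.UnitaryCanonicalModel

end
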